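import Literature.Analysis.FluidPDE.Tao2016AveragedNS.SeedScaleIgnition
import Literature.Analysis.FluidPDE.Tao2016AveragedNS.NegativeKickThreshold
import HarnessLib

/-!
# Sharp seed-scale ignition: the ignition threshold of one gate is `√(π/2)·ε²e^{-M}/√M` to four figures

HONEST FRAMING (cell `pub-fluidc`): low prior, high value-of-information experiment on Tao's
machine paradigm; NOT a claim that NS blows up.

SeedScaleIgnition.lean forces the trigger of every differentiable approximate trajectory (velocity
`V`, sup-defect `‖V - F(Y)‖ ≤ δ`, `‖Y‖ ≤ 2` on `[0,T)`, datum `δ₀`-close to (5.6)) to the ignition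
magnitude `|c| = ε²` by time `8/5` whenever `δ₀ + 2δ ≤ ε²e^{-M}/(8√M)`: its Gaussian-window lemma
only harvests the deposit of the pump on `[0, 1/√M]`, with the crude discount `e^{-G} ≥ 49/100`,
i.e. `(9/20)·ε²e^{-M}/√M` out of the full window mass `√(π/2)·ε²e^{-M}/√M = 1.2533…·ε²e^{-M}/√M`.
NegativeKickThreshold.lean showed on the other side that a NEGATIVE trigger pre-load of
`(2507/2000)ε²e^{-M}/√M = 1.2535·ε²e^{-M}/√M` stalls the exact flow for the whole cycle, and that
no pre-load `≤ (3133/2500)ε²e^{-M}/√M = 1.2532·ε²e^{-M}/√M` does.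

This file closes the gap on the ignition side, for data AND forcings: along every approximate
trajectory with `δ₀ + 2δ ≤ (3133/2500)·ε²e^{-M}/√M` the trigger exceeds `ε²` in absolute value at
some time in `[0, 8/5]` (`ignitesWithin_sharp`, stated with the
ignition property `IgnitesWithin K M ε B τ` of §0: every approximate trajectory of total budget
`δ₀ + δT ≤ B` has `|c| > ε²` somewhere on `[0, τ]`). With the
pinned dud this locates the IGNITION THRESHOLD of the gate — the least total budget `δ₀ + δT` of
datum error plus sup-forcing that can keep `|c| ≤ ε²` for a cycle — in the window
`[1.2532, 1.2535)·ε²e^{-M}/√M ∋ √(π/2)·ε²e^{-M}/√M` (`ignition_threshold_pinned`): adversarial forcing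
of any time profile buys nothing over a negative pre-load of the datum, to four significant figures.
In particular the seed-scale budget of exponent `5`, `δ₀ + δT ≤ ε²e^{-M}/K⁵ ≤ ε²e^{-M}/√M`, forces
ignition in EVERY member (`ignitesWithin_pow_five`) — the first step of the sharp chain that the
open corner case of the cell's typed question `PseudoOrbitTransitionSeed 5` requires (the transition,
equipartition and firing phases under the exponent-5 budget are NOT analysed here).

Mechanism. `D = c·e^{-G}` obeys `D' ≥ (ε²e^{-M}a² - δ)e^{-G}`. On `[0,1]`: `a² ≥ 1 - 2·10⁻⁵`
(energy), `G(u) ≤ λ⁺u² + τ₀` with `λ⁺ ≤ (M/2)(1 + 2.5·10⁻⁶)`, `τ₀ ≤ 10⁻⁷` (the clock majorant of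
SeedScaleIgnition, read as a Gaussian exponent), and `G ≥ -1/100`; hence
`D(1) ≥ -δ₀ - (51/50)δ + ε²e^{-M}(1 - 2·10⁻⁵)e^{-τ₀}∫₀¹e^{-λ⁺u²}du ≥ -δ₀ - (51/50)δ + 1.253274·ε²e^{-M}/√M`
by the Gaussian window mass FROM BELOW `∫₀¹e^{-λu²} ≥ √(π/λ)/2 - e^{-λ}/λ`
(`NegKick.integral_exp_neg_mul_sq_ge`) and `π > 3.141592`. If `|c| ≤ ε²` on `[0, 8/5]` the clock keeps
running (SeedScaleIgnition §4, valid under the weak budget `δ₀ + 2δ ≤ ε²e^{-M}/8`), so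
`D ≥ (1.253274 - 1.2532)ε²e^{-M}/√M ≥ ε²e^{-M}/(16000√M)` persists to `t = 8/5`, where
`e^{G - M} ≥ (2M/75)³` turns it into `c(8/5) > 3ε²` — a contradiction. The a-priori block of
SeedScaleIgnition §3–§4 is used in its weak-budget form (the primed lemmas of its `section Eighth`,
hypothesis `δ₀ + 2δ ≤ ε²e^{-M}/8`, which every budget of size `O(ε²e^{-M}/√M)` implies as `√M ≥ 77`);
the sharp part then assumes `δ₀ + 2δ ≤ (3133/2500)ε²e^{-M}/√M`. The negative side
(`not_ignitesWithin_of_ge`) is the pinned dud of NegativeKickThreshold.lean read as an approximate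
trajectory with defect `0`.
-/

namespace Literature.Analysis.FluidPDE.Tao2016AveragedNS

open Real Set MeasureTheory
open scoped NNReal
open NegKick (clockInt clockInt_zero)

/-! ## §0. The ignition property of a member at a given total budget -/

/-- **Ignition within budget `B` by time `τ`** for the member `(K, M, ε)` of the retuned family:
EVERY differentiable approximate trajectory `Y` (velocity `V`, sup-defect `‖V - F(Y)‖ ≤ δ` and
`‖Y‖ ≤ 2` on `[0,T)`, `T ≥ 2`) issued `δ₀`-close to the datum (5.6), with total budget
`δ₀ + δT ≤ B`, carries its trigger beyond the ignition magnitude, `|c(t)| > ε²`, at some time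
`t ∈ [0, τ]`. It is antitone in `B` and monotone in `τ`; the IGNITION THRESHOLD of the member is the
supremum of the budgets `B` with this property. (An ignition property, NOT a firing property.)
[cite: Tao2016AveragedNS, §5.5 Theorem 5.3] -/
def IgnitesWithin (K M ε B τ : ℝ) : Prop :=
  ∀ (δ δ₀ T : ℝ) (Y V : ℝ → Fin 5 → ℝ), 2 ≤ T → (∀ t, HasDerivAt Y (V t) t) →
    (∀ t ∈ Ico 0 T, ‖V t - delayCircuitWith K M ε (Y t)‖ ≤ δ) → (∀ t ∈ Ico 0 T, ‖Y t‖ ≤ 2) →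
    ‖Y 0 - delayInit‖ ≤ δ₀ → δ₀ + δ * T ≤ B → ∃ t ∈ Icc (0 : ℝ) τ, ε ^ 2 < |Y t 2|

/-- `IgnitesWithin` is antitone in the budget. [folklore] -/
theorem IgnitesWithin.anti {K M ε B B' τ : ℝ} (h : IgnitesWithin K M ε B τ) (hB : B' ≤ B) :
    IgnitesWithin K M ε B' τ :=
  fun δ δ₀ T Y V hT hY hV hR h0 hb => h δ δ₀ T Y V hT hY hV hR h0 (hb.trans hB)

/-- `IgnitesWithin` is monotone in the time allowed. [folklore] -/
theorem IgnitesWithin.mono {K M ε B τ τ' : ℝ} (h : IgnitesWithin K M ε B τ) (hτ : τ ≤ τ') :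
    IgnitesWithin K M ε B τ' := by
  intro δ δ₀ T Y V hT hY hV hR h0 hb
  obtain ⟨t, ht, hc⟩ := h δ δ₀ T Y V hT hY hV hR h0 hb
  exact ⟨t, ⟨ht.1, ht.2.trans hτ⟩, hc⟩

namespace IgnitionSharp

open Ignition

/-! ## §1. Numerical inequalities -/

/-- `c/√M ≤ √(π/λ)/2` whenever `4c²λ ≤ πM` (`c ≥ 0`, `λ, M > 0`). [folklore] -/
theorem le_sqrt_pi_div_of {M c l : ℝ} (hM : 0 < M) (hl : 0 < l) (hc : 0 ≤ c)
    (h : 4 * c ^ 2 * l ≤ π * M) : c / Real.sqrt M ≤ Real.sqrt (π / l) / 2 := by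
  have hsq0 : 0 < Real.sqrt M := Real.sqrt_pos.2 hM
  rw [le_div_iff₀ two_pos, Real.le_sqrt (by positivity) (by positivity), mul_pow, div_pow,
    Real.sq_sqrt hM.le, le_div_iff₀ hl]
  rw [show c ^ 2 / M * 2 ^ 2 * l = 4 * c ^ 2 * l / M by ring, div_le_iff₀ hM]
  exact h

/-- The Gaussian window mass for a slightly perturbed exponent: `∫₀¹e^{-λr²} dr ≥ 1.2533/√M` whenever
`M/2 ≤ λ ≤ (M/2)(1 + 1/400000)` and `M ≥ 6000` (`√(π/λ)/2 ≥ 1.25331/√M` from `π > 3.141592`, tail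
`e^{-λ}/λ ≤ 10⁻⁵/√M`; NegativeKickThreshold's `NegKick.window_mass_ge` is the case `λ = M/2`). [folklore] -/
theorem window_mass_ge_of {M l : ℝ} (hM : 6000 ≤ M) (hl1 : M / 2 ≤ l)
    (hl2 : l ≤ M / 2 * (1 + 1 / 400000)) :
    12533 / 10000 / Real.sqrt M ≤ ∫ r in (0 : ℝ)..1, exp (-l * r ^ 2) := by
  have hM0 : 0 < M := by linarith
  have hl0 : 0 < l := by linarith
  have hI := NegKick.integral_exp_neg_mul_sq_ge hl0
  have hlow : 125331 / 100000 / Real.sqrt M ≤ Real.sqrt (π / l) / 2 := by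
    refine le_sqrt_pi_div_of hM0 hl0 (by norm_num) ?_
    have hpi : (3141592 / 1000000 : ℝ) ≤ π := by
      have := Real.pi_gt_d6
      norm_num at this ⊢
      linarith
    have h1 : 4 * (125331 / 100000 : ℝ) ^ 2 * l ≤
        4 * (125331 / 100000 : ℝ) ^ 2 * (M / 2 * (1 + 1 / 400000)) :=
      mul_le_mul_of_nonneg_left hl2 (by positivity)
    have h3 : 4 * (125331 / 100000 : ℝ) ^ 2 * (M / 2 * (1 + 1 / 400000)) ≤
        3141592 / 1000000 * M := by linarith
    have h4 : (3141592 / 1000000 : ℝ) * M ≤ π * M := mul_le_mul_of_nonneg_right hpi hM0.le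
    linarith
  have htail : exp (-l) / l ≤ 1 / 100000 / Real.sqrt M := by
    have h1 : exp (-l) / l ≤ exp (-(M / 2)) / l :=
      div_le_div_of_nonneg_right (exp_le_exp.2 (by linarith)) hl0.le
    have h2 : exp (-(M / 2)) / l ≤ exp (-(M / 2)) / (M / 2) :=
      div_le_div_of_nonneg_left (exp_pos _).le (by positivity) hl1
    exact h1.trans (h2.trans (NegKick.exp_half_div_le hM))
  have e : (12533 / 10000 : ℝ) / Real.sqrt M =
      125331 / 100000 / Real.sqrt M - 1 / 100000 / Real.sqrt M := by ring
  rw [e]; linarith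

/-- The sharp budget level lies below the weak one: `(3133/2500)ε²e^{-M}/√M ≤ ε²e^{-M}/8`, as
`√M ≥ 77` under the standing hypotheses. [cite: Tao2016AveragedNS, §5.5] -/
theorem sharp_level_le_eighth {K M ε : ℝ} (hK : 2 * 20 ^ 42 * (Nat.factorial 42 : ℝ) + 16 ≤ K)
    (hML : 3000 * Real.log K ≤ M) (hMK : M ≤ K ^ 10) (hε : 0 < ε)
    (hεle : ε ≤ exp (-(10 * M)) / K ^ 100) :
    3133 / 2500 * (ε ^ 2 * exp (-M)) / Real.sqrt M ≤ ε ^ 2 * exp (-M) / 8 := by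
  obtain ⟨hM6000, -, -, -, -, -, -, h77, -⟩ := ignition_params hK hML hMK hε hεle
  have hs0 : 0 < ε ^ 2 * exp (-M) := by positivity
  have h1 : 3133 / 2500 * (ε ^ 2 * exp (-M)) / Real.sqrt M ≤
      3133 / 2500 * (ε ^ 2 * exp (-M)) / 77 :=
    div_le_div_of_nonneg_left (by positivity) (by norm_num) h77
  linarith

/-! ## §2. The Gaussian-window deposit in full, under the weak budget `δ₀ + 2δ ≤ ε²e^{-M}/8` -/

section Approx

variable {K M ε δ δ₀ T : ℝ} {Y V : ℝ → Fin 5 → ℝ}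
  (hY : ∀ t, HasDerivAt Y (V t) t)
  (hV : ∀ t ∈ Ico 0 T, ‖V t - delayCircuitWith K M ε (Y t)‖ ≤ δ)
  (hR : ∀ t ∈ Ico 0 T, ‖Y t‖ ≤ 2) (hT : 2 ≤ T)
include hY hV hR hT

section Eighth

variable (hK : 2 * 20 ^ 42 * (Nat.factorial 42 : ℝ) + 16 ≤ K) (hML : 3000 * Real.log K ≤ M)
  (hMK : M ≤ K ^ 10) (hε : 0 < ε) (hεle : ε ≤ exp (-(10 * M)) / K ^ 100)
  (h0 : ‖Y 0 - delayInit‖ ≤ δ₀) (hη : δ₀ + 2 * δ ≤ ε ^ 2 * exp (-M) / 8)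
include hK hML hMK hε hεle h0 hη


/-- **The carrier on the first unit of time, fine form**: `a(t)² ≥ 1 - 1/50000` for `t ∈ [0,1]`
(`ε² ≤ e^{-M} ≤ 4/M² ≤ 1/(9·10⁶)`: `b² ≤ 4ε²`, `c² ≤ 9ε⁴e^{-M}`, `d² + ã² ≤ 98e^{-M}`, energy
`≥ 1 - 2ε²e^{-M}`). [cite: Tao2016AveragedNS, §5.5 (energy-con)] -/
theorem a_sq_ge_unit_fine {t : ℝ} (ht : t ∈ Icc (0 : ℝ) 1) : 1 - 1 / 50000 ≤ Y t 0 ^ 2 := by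
  obtain ⟨hM6000, hε1, hε2, hexpM, hMe, -, hMse, -, -⟩ := ignition_params hK hML hMK hε hεle
  obtain ⟨hε2e, heM, hM9, -⟩ := NegKick.negKick_params_fine hK hML hMK hε hεle
  obtain ⟨hδ₀, hδ, hη8, hδ₀1, h732, hs1⟩ := budget_facts' hV hT hK hML hMK hε hεle h0 hη
  have ht' : t ∈ Icc (0 : ℝ) (8 / 5) := ⟨ht.1, by linarith [ht.2]⟩
  have hE := (abs_le.1 (abs_energy_sub_one_le hY hV hR hT h0 hδ₀1 ht')).1
  rw [energy_five] at hE
  obtain ⟨hb1, hb2⟩ := b_bounds_unit' hY hV hR hT hK hML hMK hε hεle h0 hη ht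
  have hc := abs_c_le_unit' hY hV hR hT hK hML hMK hε hεle h0 hη ht
  obtain ⟨hd, he⟩ := de_le_unit' hY hV hR hT hK hML hMK hε hεle h0 hη ht
  have hb : Y t 1 ^ 2 ≤ 4 * ε ^ 2 := by nlinarith
  have hsq : ∀ x C : ℝ, |x| ≤ C → x ^ 2 ≤ C ^ 2 := fun x C h => by
    rw [← sq_abs]; exact pow_le_pow_left₀ (abs_nonneg x) h 2
  have hc2 := hsq _ _ hc
  have hd2 := hsq _ _ hd
  have he2 := hsq _ _ he
  have hex : exp (-(M / 2)) ^ 2 = exp (-M) := by rw [← exp_nat_mul]; ring_nf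
  have heM' : exp (-M) ≤ 1 / 9000000 := heM.trans hM9
  have h1 : (3 * ε ^ 2 * exp (-(M / 2))) ^ 2 ≤ 1 / 9000000 := by
    have e1 : (3 * ε ^ 2 * exp (-(M / 2))) ^ 2 = 9 * (ε ^ 2) ^ 2 * exp (-M) := by
      rw [mul_pow, mul_pow, hex]; ring
    have e2 : (ε ^ 2) ^ 2 ≤ ε ^ 2 * (1 / 100000) := by
      rw [sq]; exact mul_le_mul_of_nonneg_left hε2 (sq_nonneg ε)
    have e3 : 9 * (ε ^ 2) ^ 2 * exp (-M) ≤ 9 * (ε ^ 2) ^ 2 * 1 :=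
      mul_le_mul_of_nonneg_left (by linarith) (by positivity)
    rw [e1]; linarith
  have h2 : (7 * exp (-(M / 2))) ^ 2 ≤ 49 / 9000000 := by
    have e7 : (7 : ℝ) ^ 2 = 49 := by norm_num
    rw [mul_pow, hex, e7]; linarith
  have h3 : 4 * ε ^ 2 ≤ 4 / 9000000 := by linarith [hε2e.trans heM']
  linarith

omit hY hR in
/-- **The Gaussian exponent and offset of the clock majorant**: with `ν = 7δ₀ + 32δ`,
`λ⁺ = ε⁻¹M(ε(1+ν)+δ)/2` satisfies `M/2 ≤ λ⁺ ≤ (M/2)(1 + 1/400000)` and `τ₀ = ε⁻¹Mδ₀ ≤ 10⁻⁷`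
(`ν ≤ 2ε²e^{-M}`, `δ/ε ≤ εe^{-M}/16`, `Mε e^{-M} ≤ 4ε/M`, `ε ≤ 1/3000`). [cite: Tao2016AveragedNS, §5.5] -/
theorem gauss_consts :
    M / 2 ≤ ε⁻¹ * M * (ε * (1 + 7 * δ₀ + 32 * δ) + δ) / 2 ∧
      ε⁻¹ * M * (ε * (1 + 7 * δ₀ + 32 * δ) + δ) / 2 ≤ M / 2 * (1 + 1 / 400000) ∧
      ε⁻¹ * M * δ₀ ≤ 1 / 10000000 := by
  obtain ⟨hM6000, hε1, hε2, hexpM, hMe, -, hMse, -, -⟩ := ignition_params hK hML hMK hε hεle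
  obtain ⟨hε2e, heM, hM9, -⟩ := NegKick.negKick_params_fine hK hML hMK hε hεle
  obtain ⟨hδ₀, hδ, hη8, hδ₀1, h732, hs1⟩ := budget_facts' hV hT hK hML hMK hε hεle h0 hη
  have hM0 : 0 < M := by linarith
  have hε3000 : ε ≤ 1 / 3000 :=
    le_of_pow_le_pow_left₀ two_ne_zero (by norm_num) ((hε2e.trans (heM.trans hM9)).trans (by norm_num))
  have hsplit : ε⁻¹ * M * (ε * (1 + 7 * δ₀ + 32 * δ) + δ) / 2 =
      M / 2 + M / 2 * (7 * δ₀ + 32 * δ) + ε⁻¹ * M * δ / 2 := by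
    field_simp; ring
  refine ⟨?_, ?_, ?_⟩
  · rw [hsplit]
    have h1 : 0 ≤ M / 2 * (7 * δ₀ + 32 * δ) := by positivity
    have h2 : 0 ≤ ε⁻¹ * M * δ / 2 := by positivity
    linarith
  · rw [hsplit]
    have h1 : M / 2 * (7 * δ₀ + 32 * δ) ≤ M / 2 * (2 / 1000000) :=
      mul_le_mul_of_nonneg_left (by linarith) (by positivity)
    -- ε⁻¹Mδ ≤ ε⁻¹M·(ε²e^{-M}/16) = Mεe^{-M}/16 ≤ (M/2)·(εe^{-M}/8)
    have h2 : ε⁻¹ * M * δ ≤ ε⁻¹ * M * (ε ^ 2 * exp (-M) / 16) :=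
      mul_le_mul_of_nonneg_left (by linarith) (by positivity)
    have h3 : ε⁻¹ * M * (ε ^ 2 * exp (-M) / 16) = M / 2 * (ε * exp (-M) / 8) := by
      field_simp; ring
    have h4 : ε * exp (-M) / 8 ≤ 1 / 4000000 := by
      have : ε * exp (-M) ≤ 1 / 3000 * (1 / 9000000) :=
        mul_le_mul hε3000 (heM.trans hM9) (exp_pos _).le (by norm_num)
      linarith
    have h5 : M / 2 * (ε * exp (-M) / 8) ≤ M / 2 * (1 / 4000000) :=
      mul_le_mul_of_nonneg_left h4 (by positivity)
    linarith [h1, h2, h3, h5]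
  · -- ε⁻¹Mδ₀ ≤ ε⁻¹M·ε²e^{-M}/8 = Mεe^{-M}/8 ≤ M ε (4/M²)/8 = ε/(2M) ≤ 10⁻⁷
    have h1 : ε⁻¹ * M * δ₀ ≤ ε⁻¹ * M * (ε ^ 2 * exp (-M) / 8) :=
      mul_le_mul_of_nonneg_left (by linarith) (by positivity)
    have h2 : ε⁻¹ * M * (ε ^ 2 * exp (-M) / 8) = M * ε * exp (-M) / 8 := by field_simp
    have h3 : M * ε * exp (-M) ≤ M * ε * (4 / M ^ 2) :=
      mul_le_mul_of_nonneg_left heM (by positivity)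
    have h4 : M * ε * (4 / M ^ 2) = 4 * ε / M := by field_simp
    have h5 : 4 * ε / M ≤ 4 * (1 / 3000) / 6000 := by
      rw [div_le_div_iff₀ hM0 (by norm_num)]
      linarith
    linarith

/-- **The clock on the first unit of time, Gaussian form**: `G(u) ≤ λ⁺u² + τ₀` on `[0,1]`
(`G ≤ G⁺` and `δ₀u ≤ δ₀`). [cite: Tao2016AveragedNS, §5.5] -/
theorem clockInt_le_gauss {u : ℝ} (hu : u ∈ Icc (0 : ℝ) 1) :
    clockInt ε M Y u ≤
      ε⁻¹ * M * (ε * (1 + 7 * δ₀ + 32 * δ) + δ) / 2 * u ^ 2 + ε⁻¹ * M * δ₀ := by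
  obtain ⟨hM6000, -, -, -, -, -, -, -, -⟩ := ignition_params hK hML hMK hε hεle
  obtain ⟨hδ₀, hδ, -, hδ₀1, -, -⟩ := budget_facts' hV hT hK hML hMK hε hεle h0 hη
  have hM : 0 ≤ M := by linarith
  have hu' : u ∈ Icc (0 : ℝ) (8 / 5) := ⟨hu.1, by linarith [hu.2]⟩
  have h1 := clockInt_le_clockSup hY hV hR hT h0 hδ₀1 hε hM hu'
  have h2 : ε⁻¹ * M * (δ₀ * u) ≤ ε⁻¹ * M * δ₀ := by
    have : δ₀ * u ≤ δ₀ := by nlinarith [hu.2]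
    exact mul_le_mul_of_nonneg_left this (by positivity)
  have h3 : clockSup M ε δ δ₀ u = ε⁻¹ * M * (δ₀ * u) +
      ε⁻¹ * M * (ε * (1 + 7 * δ₀ + 32 * δ) + δ) / 2 * u ^ 2 := by
    unfold clockSup; ring
  linarith

/-- **The trigger equation on `[0,1]`, Gaussian form**: with `s = ε²e^{-M}`, `λ⁺`, `τ₀` as in
`gauss_consts`, `D' ≥ s(1 - 2·10⁻⁵)e^{-τ₀}e^{-λ⁺u²} - (51/50)δ` (`a² ≥ 1 - 2·10⁻⁵`, `G ≤ λ⁺u² + τ₀`,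
`G ≥ -1/100` and `e^{1/100} ≤ 51/50`). [cite: Tao2016AveragedNS, §5.5 proof of Theorem 5.3] -/
theorem disc_deriv_ge_gauss {u : ℝ} (hu : u ∈ Icc (0 : ℝ) 1) :
    ε ^ 2 * exp (-M) * (1 - 1 / 50000) * exp (-(ε⁻¹ * M * δ₀)) *
          exp (-(ε⁻¹ * M * (ε * (1 + 7 * δ₀ + 32 * δ) + δ) / 2) * u ^ 2) - 51 / 50 * δ ≤
      (V u 2 - ε⁻¹ * M * Y u 1 * Y u 2) * exp (-clockInt ε M Y u) := by
  obtain ⟨hM6000, -, -, -, -, -, -, -, -⟩ := ignition_params hK hML hMK hε hεle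
  obtain ⟨hδ₀, hδ, -, -, -, -⟩ := budget_facts' hV hT hK hML hMK hε hεle h0 hη
  have hM : 0 ≤ M := by linarith
  have hu' : u ∈ Icc (0 : ℝ) (8 / 5) := ⟨hu.1, by linarith [hu.2]⟩
  have h1 := disc_deriv_geA hV hT hu' (K := K)
  have ha := a_sq_ge_unit_fine hY hV hR hT hK hML hMK hε hεle h0 hη hu
  have hGle := clockInt_le_gauss hY hV hR hT hK hML hMK hε hεle h0 hη hu
  have hGge : -(1 / 100) ≤ clockInt ε M Y u := by
    have h := clockInt_ge_unit' hY hV hR hT hK hML hMK hε hεle h0 hη hu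
    have hMu : 0 ≤ M * u ^ 2 := mul_nonneg hM (sq_nonneg u)
    linarith
  have he : exp (1 / 100 : ℝ) ≤ 51 / 50 := by
    have h := add_one_le_exp (-(1 / 100 : ℝ))
    have h' : exp (1 / 100 : ℝ) * exp (-(1 / 100 : ℝ)) = 1 := by rw [← exp_add]; simp
    nlinarith [exp_pos (1 / 100 : ℝ), exp_pos (-(1 / 100 : ℝ))]
  obtain ⟨l, hl⟩ : ∃ l : ℝ, l = ε⁻¹ * M * (ε * (1 + 7 * δ₀ + 32 * δ) + δ) / 2 := ⟨_, rfl⟩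
  obtain ⟨τ₀, hτ₀⟩ : ∃ τ₀ : ℝ, τ₀ = ε⁻¹ * M * δ₀ := ⟨_, rfl⟩
  obtain ⟨s, hs⟩ : ∃ s : ℝ, s = ε ^ 2 * exp (-M) := ⟨_, rfl⟩
  rw [← hl, ← hτ₀] at hGle ⊢
  rw [← hs] at h1 ⊢
  have hs0 : 0 < s := by rw [hs]; positivity
  have h2 : exp (-τ₀) * exp (-l * u ^ 2) ≤ exp (-clockInt ε M Y u) := by
    rw [← exp_add]; exact exp_le_exp.2 (by linarith)
  have h3 : s * (1 - 1 / 50000) * exp (-τ₀) * exp (-l * u ^ 2) ≤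
      s * Y u 0 ^ 2 * exp (-clockInt ε M Y u) :=
    calc s * (1 - 1 / 50000) * exp (-τ₀) * exp (-l * u ^ 2)
        = s * (1 - 1 / 50000) * (exp (-τ₀) * exp (-l * u ^ 2)) := by ring
      _ ≤ s * Y u 0 ^ 2 * exp (-clockInt ε M Y u) :=
          mul_le_mul (mul_le_mul_of_nonneg_left ha hs0.le) h2 (by positivity) (by positivity)
  have h4 : δ * exp (-clockInt ε M Y u) ≤ 51 / 50 * δ := by
    have h5 : exp (-clockInt ε M Y u) ≤ 51 / 50 := (exp_le_exp.2 (by linarith)).trans he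
    nlinarith [exp_pos (-clockInt ε M Y u)]
  have h5 : (s * Y u 0 ^ 2 - δ) * exp (-clockInt ε M Y u) =
      s * Y u 0 ^ 2 * exp (-clockInt ε M Y u) - δ * exp (-clockInt ε M Y u) := by ring
  linarith

/-- **The sharp Gaussian-window deposit, integral form**: by comparison of derivatives on `[0,1]`,
`D(1) ≥ -δ₀ - (51/50)δ + s(1 - 2·10⁻⁵)e^{-τ₀}∫₀¹e^{-λ⁺r²}dr`.
[cite: Tao2016AveragedNS, §5.5 proof of Theorem 5.3] -/
theorem disc_one_ge_integral :
    -δ₀ - 51 / 50 * δ + ε ^ 2 * exp (-M) * (1 - 1 / 50000) * exp (-(ε⁻¹ * M * δ₀)) *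
        ∫ r in (0 : ℝ)..1, exp (-(ε⁻¹ * M * (ε * (1 + 7 * δ₀ + 32 * δ) + δ) / 2) * r ^ 2) ≤
      Y 1 2 * exp (-clockInt ε M Y 1) := by
  obtain ⟨l, hl⟩ : ∃ l : ℝ, l = ε⁻¹ * M * (ε * (1 + 7 * δ₀ + 32 * δ) + δ) / 2 := ⟨_, rfl⟩
  obtain ⟨A, hA⟩ : ∃ A : ℝ, A = ε ^ 2 * exp (-M) * (1 - 1 / 50000) * exp (-(ε⁻¹ * M * δ₀)) :=
    ⟨_, rfl⟩
  rw [← hl, ← hA]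
  have hcont : Continuous fun r : ℝ => exp (-l * r ^ 2) := by fun_prop
  have hmono := Thm53.monotoneOn_sub_of_le_deriv (s := Icc (0 : ℝ) 1)
    (f := fun u => Y u 2 * exp (-clockInt ε M Y u))
    (φ := fun u => A * exp (-l * u ^ 2) - 51 / 50 * δ)
    (Φ := fun u => A * (∫ r in (0 : ℝ)..u, exp (-l * r ^ 2)) - 51 / 50 * δ * u)
    (convex_Icc 0 1) (fun u _ => hasDerivAt_discA hY u)
    (fun u _ => ((((hcont.integral_hasStrictDerivAt 0 u).hasDerivAt).const_mul A).sub
      ((hasDerivAt_id' u).const_mul (51 / 50 * δ))).congr_deriv (by ring))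
    (fun u hu => by
      show A * exp (-l * u ^ 2) - 51 / 50 * δ ≤ _
      have h := disc_deriv_ge_gauss hY hV hR hT hK hML hMK hε hεle h0 hη hu
      rw [← hl, ← hA] at h
      exact h)
  have h := hmono (left_mem_Icc.2 zero_le_one) (right_mem_Icc.2 zero_le_one) zero_le_one
  simp only [clockInt_zero, neg_zero, exp_zero, mul_one, intervalIntegral.integral_same,
    mul_zero, sub_zero] at h
  have hc0 := (abs_le.1 (abs_init_coord_le h0).2.1).1
  linarith

/-- **The sharp Gaussian-window deposit.** At `u = 1` the discounted trigger satisfies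
`D(1) ≥ -δ₀ - (51/50)δ + 1.253274·ε²e^{-M}/√M` (`∫₀¹e^{-λ⁺r²} ≥ 1.2533/√M` by `window_mass_ge_of`,
`e^{-τ₀} ≥ 1 - 10⁻⁷`, `(1 - 2·10⁻⁵)(1 - 10⁻⁷)·1.2533 ≥ 1.253274`). Compare SeedScaleIgnition's
`disc_window`: `(9/20)ε²e^{-M}/√M` at `u = 1/√M`. [cite: Tao2016AveragedNS, §5.5 proof of Theorem 5.3] -/
theorem disc_one_ge :
    -δ₀ - 51 / 50 * δ + 1253274 / 1000000 * (ε ^ 2 * exp (-M)) / Real.sqrt M ≤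
      Y 1 2 * exp (-clockInt ε M Y 1) := by
  obtain ⟨hM6000, -, -, -, -, -, -, h77, -⟩ := ignition_params hK hML hMK hε hεle
  obtain ⟨hl1, hl2, hτ⟩ := gauss_consts hV hT hK hML hMK hε hεle h0 hη
  have hraw := disc_one_ge_integral hY hV hR hT hK hML hMK hε hεle h0 hη
  obtain ⟨l, hl⟩ : ∃ l : ℝ, l = ε⁻¹ * M * (ε * (1 + 7 * δ₀ + 32 * δ) + δ) / 2 := ⟨_, rfl⟩
  obtain ⟨τ₀, hτ₀⟩ : ∃ τ₀ : ℝ, τ₀ = ε⁻¹ * M * δ₀ := ⟨_, rfl⟩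
  obtain ⟨s, hs⟩ : ∃ s : ℝ, s = ε ^ 2 * exp (-M) := ⟨_, rfl⟩
  rw [← hl] at hl1 hl2 hraw
  rw [← hτ₀] at hτ hraw
  rw [← hs] at hraw ⊢
  have hs0 : 0 < s := by rw [hs]; positivity
  have hsq0 : 0 < Real.sqrt M := by linarith
  have hW := window_mass_ge_of hM6000 hl1 hl2
  have heτ : 1 - 1 / 10000000 ≤ exp (-τ₀) := by
    have h := add_one_le_exp (-τ₀)
    linarith
  have hAW : 1253274 / 1000000 * s / Real.sqrt M ≤
      s * (1 - 1 / 50000) * exp (-τ₀) * ∫ r in (0 : ℝ)..1, exp (-l * r ^ 2) := by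
    have h1 : s * (1 - 1 / 50000) * (1 - 1 / 10000000) ≤ s * (1 - 1 / 50000) * exp (-τ₀) :=
      mul_le_mul_of_nonneg_left heτ (by positivity)
    have h2 : s * (1 - 1 / 50000) * (1 - 1 / 10000000) * (12533 / 10000 / Real.sqrt M) ≤
        s * (1 - 1 / 50000) * exp (-τ₀) * ∫ r in (0 : ℝ)..1, exp (-l * r ^ 2) :=
      mul_le_mul h1 hW (by positivity) (by positivity)
    have h3 : 1253274 / 1000000 * s / Real.sqrt M ≤
        s * (1 - 1 / 50000) * (1 - 1 / 10000000) * (12533 / 10000 / Real.sqrt M) := by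
      rw [show s * (1 - 1 / 50000) * (1 - 1 / 10000000) * (12533 / 10000 / Real.sqrt M) =
        (1 - 1 / 50000) * (1 - 1 / 10000000) * (12533 / 10000) * s / Real.sqrt M by ring]
      have hnum : (1253274 / 1000000 : ℝ) ≤
          (1 - 1 / 50000) * (1 - 1 / 10000000) * (12533 / 10000) := by norm_num
      exact div_le_div_of_nonneg_right (mul_le_mul_of_nonneg_right hnum hs0.le) hsq0.le
    exact h3.trans h2
  linarith

end Eighth

/-! ## §3. The sharp budget: ignition is forced below `(3133/2500)·ε²e^{-M}/√M` -/

section Sharp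

variable (hK : 2 * 20 ^ 42 * (Nat.factorial 42 : ℝ) + 16 ≤ K) (hML : 3000 * Real.log K ≤ M)
  (hMK : M ≤ K ^ 10) (hε : 0 < ε) (hεle : ε ≤ exp (-(10 * M)) / K ^ 100)
  (h0 : ‖Y 0 - delayInit‖ ≤ δ₀)
  (hηS : δ₀ + 2 * δ ≤ 3133 / 2500 * (ε ^ 2 * exp (-M)) / Real.sqrt M)
include hK hML hMK hε hεle h0 hηS

/-- If `|c| ≤ ε²` on the window, the discounted trigger keeps a positive part of its deposit:
`D(t) ≥ ε²e^{-M}/(16000√M)` for `t ∈ [1, 8/5]` (`1.253274 - 1.2532 ≥ 1/16000`; the budget removes at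
most `δ₀ + (51/50)(8/5)δ ≤ δ₀ + 2δ`). [cite: Tao2016AveragedNS, §5.5] -/
theorem disc_ge_of_small_sharp (hc : ∀ t ∈ Icc (0 : ℝ) (8 / 5), |Y t 2| ≤ ε ^ 2) {t : ℝ}
    (ht : t ∈ Icc (1 : ℝ) (8 / 5)) :
    ε ^ 2 * exp (-M) / (16000 * Real.sqrt M) ≤ Y t 2 * exp (-clockInt ε M Y t) := by
  obtain ⟨hM6000, hε1, hε2, hexpM, hMe, hMe2, hMse, h77, hsM⟩ := ignition_params hK hML hMK hε hεle
  have hη := hηS.trans (sharp_level_le_eighth hK hML hMK hε hεle)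
  obtain ⟨hδ₀, hδ, hη8, hδ₀1, h732, hs1⟩ := budget_facts' hV hT hK hML hMK hε hεle h0 hη
  have hsq0 : 0 < Real.sqrt M := by linarith
  have hwin := disc_one_ge hY hV hR hT hK hML hMK hε hεle h0 hη
  have hp := disc_persist' hY hV hT hK hML hMK hε hεle h0 hη (τ := 8 / 5) le_rfl
    (fun u hu => clockInt_ge_of_small' hY hV hT hK hML hMK hε hεle h0 hη hc hu) zero_le_one ht.1 ht.2
  have h1 : 102 / 100 * δ * (t - 1) ≤ 102 / 100 * δ * (3 / 5) :=
    mul_le_mul_of_nonneg_left (by linarith [ht.2]) (by positivity)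
  have h2 : ε ^ 2 * exp (-M) / (16000 * Real.sqrt M) =
      1253274 / 1000000 * (ε ^ 2 * exp (-M)) / Real.sqrt M -
        12532115 / 10000000 * (ε ^ 2 * exp (-M)) / Real.sqrt M := by
    field_simp; ring
  have h3 : 3133 / 2500 * (ε ^ 2 * exp (-M)) / Real.sqrt M ≤
      12532115 / 10000000 * (ε ^ 2 * exp (-M)) / Real.sqrt M :=
    div_le_div_of_nonneg_right (by nlinarith [mul_pos (pow_pos hε 2) (exp_pos (-M))]) hsq0.le
  rw [h2]
  linarith

end Sharp

end Approx

end IgnitionSharp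

/-! ## §4. Exported statements -/

section Export

open Ignition IgnitionSharp

variable {K M ε : ℝ} (hK : 2 * 20 ^ 42 * (Nat.factorial 42 : ℝ) + 16 ≤ K)
  (hML : 3000 * Real.log K ≤ M) (hMK : M ≤ K ^ 10) (hε : 0 < ε)
  (hεle : ε ≤ exp (-(10 * M)) / K ^ 100)
include hK hML hMK hε hεle

/-- **Sharp seed-scale ignition (Tao 2016 §5.5, approximate trajectories).** Every member of the
retuned family under the standing hypotheses of its Theorem 5.3 ignites within the total budget
`(3133/2500)·ε²e^{-M}/√M = 1.2532·ε²e^{-M}/√M` by time `8/5`: every differentiable approximate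
trajectory (velocity `V`, `‖V - F(Y)‖ ≤ δ` and `‖Y‖ ≤ 2` on `[0,T)`, `T ≥ 2`) issued `δ₀`-close to the
datum (5.6) with `δ₀ + δT ≤ (3133/2500)·ε²e^{-M}/√M` has `|c(t)| > ε²` at some `t ∈ [0, 8/5]`
(SeedScaleIgnition's `ignition_forced` had the budget `ε²e^{-M}/(8√M)`). NOT a firing theorem.
[cite: Tao2016AveragedNS, §5.5 Theorem 5.3] -/
theorem ignitesWithin_sharp :
    IgnitesWithin K M ε (3133 / 2500 * (ε ^ 2 * exp (-M)) / Real.sqrt M) (8 / 5) := by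
  intro δ δ₀ T Y V hT hY hV hR h0 hB
  have hδ : 0 ≤ δ := defect_nonneg hV hT
  have hηS : δ₀ + 2 * δ ≤ 3133 / 2500 * (ε ^ 2 * exp (-M)) / Real.sqrt M := by nlinarith
  -- if `|c| ≤ ε²` on `[0, 8/5]` then `c(8/5) = D(8/5)e^{G(8/5)} ≥ ε²·(2M/75)³/(16000√M) > 3ε²`
  obtain ⟨hM6000, hε1, hε2, hexpM, hMe, hMe2, hMse, h77, hsM⟩ := ignition_params hK hML hMK hε hεle
  have hη := hηS.trans (sharp_level_le_eighth hK hML hMK hε hεle)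
  have hM0 : 0 < M := by linarith
  have hsq0 : 0 < Real.sqrt M := by linarith
  by_contra hcon
  simp only [not_exists, not_and, not_lt] at hcon
  have hc : ∀ t ∈ Icc (0 : ℝ) (8 / 5), |Y t 2| ≤ ε ^ 2 := fun t ht => hcon t ht
  have hD := disc_ge_of_small_sharp hY hV hR hT hK hML hMK hε hεle h0 hηS hc (t := 8 / 5)
    ⟨by norm_num, le_rfl⟩
  have hG := clockInt_late_of_small' hY hV hR hT hK hML hMK hε hεle h0 hη hc
  -- e^{G(8/5) - M} ≥ (2M/75)³
  obtain ⟨x, hx⟩ : ∃ x : ℝ, x = clockInt ε M Y (8 / 5) - M := ⟨_, rfl⟩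
  have hx1 : 2 * M / 25 ≤ x := by rw [hx]; linarith
  have hx0 : 0 ≤ x := by linarith
  have hEG : (2 * M / 75) ^ 3 ≤ exp x := by
    have h1 : exp x = exp (x / 3) ^ 3 := by rw [← exp_nat_mul]; ring_nf
    rw [h1]
    calc (2 * M / 75) ^ 3 ≤ (x / 3 + 1) ^ 3 := pow_le_pow_left₀ (by positivity) (by linarith) 3
      _ ≤ exp (x / 3) ^ 3 := pow_le_pow_left₀ (by positivity) (add_one_le_exp (x / 3)) 3
  -- c(8/5) = D(8/5)·e^{G(8/5)}
  have hc85 : ε ^ 2 * exp (-M) / (16000 * Real.sqrt M) * exp (clockInt ε M Y (8 / 5)) ≤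
      Y (8 / 5) 2 := by
    have h1 : Y (8 / 5) 2 = (Y (8 / 5) 2 * exp (-clockInt ε M Y (8 / 5))) *
        exp (clockInt ε M Y (8 / 5)) := by rw [mul_assoc, ← exp_add]; simp
    rw [h1]
    exact mul_le_mul_of_nonneg_right hD (exp_pos _).le
  have hkey : ε ^ 2 < ε ^ 2 * exp (-M) / (16000 * Real.sqrt M) * exp (clockInt ε M Y (8 / 5)) := by
    have h1 : ε ^ 2 * exp (-M) / (16000 * Real.sqrt M) * exp (clockInt ε M Y (8 / 5)) =
        ε ^ 2 / (16000 * Real.sqrt M) * exp x := by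
      rw [hx, exp_sub, exp_neg]; field_simp
    rw [h1]
    have h2 : ε ^ 2 / (16000 * Real.sqrt M) * (2 * M / 75) ^ 3 ≤
        ε ^ 2 / (16000 * Real.sqrt M) * exp x :=
      mul_le_mul_of_nonneg_left hEG (by positivity)
    have hMs : M / Real.sqrt M = Real.sqrt M := Real.div_sqrt
    have h3 : ε ^ 2 / (16000 * Real.sqrt M) * (2 * M / 75) ^ 3 =
        8 / (16000 * 421875) * ε ^ 2 * M ^ 2 * (M / Real.sqrt M) := by
      field_simp; ring
    rw [hMs] at h3
    have h4 : (36000000 : ℝ) ≤ M ^ 2 := by nlinarith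
    have h5 : (36000000 : ℝ) * 77 ≤ M ^ 2 * Real.sqrt M := mul_le_mul h4 h77 (by norm_num) (by positivity)
    have h6 : ε ^ 2 < 8 / (16000 * 421875) * ε ^ 2 * M ^ 2 * Real.sqrt M := by
      have h61 : (1 : ℝ) < 8 / (16000 * 421875) * (M ^ 2 * Real.sqrt M) := by nlinarith
      have h62 := mul_lt_mul_of_pos_left h61 (pow_pos hε 2)
      linarith [h62]
    linarith [h2, h3]
  have hlast := hc (8 / 5) ⟨by norm_num, le_rfl⟩
  have habs : Y (8 / 5) 2 ≤ |Y (8 / 5) 2| := le_abs_self _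
  linarith

/-- **The exponent-`5` budget forces ignition, in every member.** Every member ignites within the
total budget `ε²e^{-M}/K⁵` (the budget of the cell's typed seed-scale question at exponent `q = 5`;
`ε²e^{-M}/K⁵ ≤ ε²e^{-M}/√M` as `M ≤ K¹⁰`) by time `8/5`. (First step of the sharp chain for
`PseudoOrbitTransitionSeed 5`; the later phases are not analysed here.)
[cite: Tao2016AveragedNS, §5.5 Theorem 5.3] -/
theorem ignitesWithin_pow_five : IgnitesWithin K M ε (ε ^ 2 * exp (-M) / K ^ 5) (8 / 5) := by
  obtain ⟨hK16, hM4, -⟩ := negKick_params hK hML hMK hε hεle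
  have hM0 : 0 < M := by linarith
  have hsq0 : 0 < Real.sqrt M := Real.sqrt_pos.2 hM0
  have hs : 0 ≤ ε ^ 2 * exp (-M) := by positivity
  have hsqK : Real.sqrt M ≤ K ^ 5 := by
    rw [Real.sqrt_le_left (by positivity)]
    calc M ≤ K ^ 10 := hMK
      _ = (K ^ 5) ^ 2 := by ring
  refine (ignitesWithin_sharp hK hML hMK hε hεle).anti ?_
  calc ε ^ 2 * exp (-M) / K ^ 5 ≤ ε ^ 2 * exp (-M) / Real.sqrt M :=
        div_le_div_of_nonneg_left hs hsq0 hsqK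
    _ = 1 * (ε ^ 2 * exp (-M)) / Real.sqrt M := by ring
    _ ≤ 3133 / 2500 * (ε ^ 2 * exp (-M)) / Real.sqrt M := by gcongr; norm_num

/-- **No ignition within the budget `(2507/2000)·ε²e^{-M}/√M`, even in time `2`.** The pinned
negative-kick dud of NegativeKickThreshold.lean is an EXACT trajectory of the member (defect `0`,
energy one, hence `‖Y‖ ≤ 1`) issued from a datum at distance `κ < (2507/2000)ε²e^{-M}/√M` from
(5.6) whose trigger stays in `[-3ε²e^{-M}, 0] ⊂ (-ε², ε²)` for the whole cycle `[0, 2]`.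
[cite: Tao2016AveragedNS, §5.5 Theorem 5.3] -/
theorem not_ignitesWithin_of_ge {B τ : ℝ}
    (hB : 2507 / 2000 * (ε ^ 2 * exp (-M)) / Real.sqrt M ≤ B) (hτ : τ ≤ 2) :
    ¬ IgnitesWithin K M ε B τ := by
  intro h
  obtain ⟨κ, hκ1, hκ2, -, hc⟩ := exists_negativeKick_dud_pinned hK hML hMK hε hεle
  obtain ⟨hM6000, hε1, hε2, hexpM, -, -, -, h77, -⟩ := Ignition.ignition_params hK hML hMK hε hεle
  have hs0 : 0 < ε ^ 2 * exp (-M) := by positivity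
  have hκ0 : 0 < κ := lt_of_le_of_lt (by positivity) hκ1
  have hs3 : 3 * (ε ^ 2 * exp (-M)) < ε ^ 2 := by nlinarith [pow_pos hε 2]
  have hκle : κ ≤ 1 := by
    have h1 : 2507 / 2000 * (ε ^ 2 * exp (-M)) / Real.sqrt M ≤ 2507 / 2000 * (ε ^ 2 * exp (-M)) :=
      div_le_self (by positivity) (by linarith)
    nlinarith [pow_pos hε 2, exp_pos (-M)]
  have hκsq : (-κ) ^ 2 ≤ 1 := by nlinarith
  -- the dud as an approximate trajectory with defect `0`, datum error `κ`, on the window `[0, 2)`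
  obtain ⟨t, ht, hct⟩ := h 0 κ 2 (fun t => delayFlowWith K M ε t (kickInit (-κ)))
    (fun t => delayCircuitWith K M ε (delayFlowWith K M ε t (kickInit (-κ)))) le_rfl
    (fun t => hasDerivAt_delayFlowWith K M ε (kickInit (-κ)) t)
    (fun t _ => by simp)
    (fun t _ => (norm_delayFlowWith_le K M ε (kickInit (-κ)) t).trans
      (by rw [energy_kickInit hκsq, Real.sqrt_one]; norm_num))
    (by rw [delayFlowWith_zero]; exact norm_kickInit_neg_sub_delayInit hκ0.le hκle)
    (by linarith)
  obtain ⟨hle, hge, -, -⟩ := hc t ⟨ht.1, ht.2.trans hτ⟩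
  have habs : |delayFlowWith K M ε t (kickInit (-κ)) 2| < ε ^ 2 := by
    rw [abs_lt]; constructor <;> linarith
  exact absurd hct (not_lt.2 habs.le)

/-- **The ignition threshold of the gate is pinned to `[1.2532, 1.2535)·ε²e^{-M}/√M ∋ √(π/2)·ε²e^{-M}/√M`.**
For every time horizon `τ ∈ [8/5, 2]`: the member ignites within the total budget
`(3133/2500)ε²e^{-M}/√M` by time `τ`, and does NOT ignite within `(2507/2000)ε²e^{-M}/√M` by time `τ`
— forcing of arbitrary time profile is no more efficient at stalling the gate than a negative
pre-load of the datum, to four significant figures (SeedScaleIgnition's `stall_threshold_two_sided`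
had the window `[1/8, 2)·ε²e^{-M}/√M`). [cite: Tao2016AveragedNS, §5.5 Theorem 5.3] -/
theorem ignition_threshold_pinned {τ : ℝ} (hτ : τ ∈ Icc (8 / 5 : ℝ) 2) :
    IgnitesWithin K M ε (3133 / 2500 * (ε ^ 2 * exp (-M)) / Real.sqrt M) τ ∧
      ¬ IgnitesWithin K M ε (2507 / 2000 * (ε ^ 2 * exp (-M)) / Real.sqrt M) τ :=
  ⟨(ignitesWithin_sharp hK hML hMK hε hεle).mono hτ.1,
    not_ignitesWithin_of_ge hK hML hMK hε hεle le_rfl hτ.2⟩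

end Export

end Literature.Analysis.FluidPDE.Tao2016AveragedNS
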